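import Literature.MathematicalPhysics.QuantumFieldTheory.BalabanImbrieJaffe1984to88.BIJ88Ineq595Proof
import Literature.MathematicalPhysics.QuantumFieldTheory.BalabanImbrieJaffe1984to88.BIJ88SmallCoupling23
import Literature.MathematicalPhysics.QuantumFieldTheory.Balaban1983to89.B2Sect2Statements

/-!
# `BalabanImbrieJaffe1984to88.BIJ88Display297Cloc` — T. Bałaban, J. Imbrie, A. Jaffe, *Effective action and cluster
properties of the abelian Higgs model*, Commun. Math. Phys. **114** (1988) 257–315 [BalabanImbrieJaffe1988]:
the located inference of p. 297 [PDF 41], verbatim *"We want a similar bound for φ^{(k)}(x), x ∈ Λ₇^{(k)}. Note that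
C^{(k)}_{loc}(u_{k+1}) is almost equal to C^{(k)}(u_{k+1}). Thus we have that in Λ₇^{(k)}, say,
aL^{−2}C^{(k)}_{loc}(u_{k+1})Q(u_{k+1})*ψ = Q(u_{k+1})*ψ + O(p(e_k)), (the corresponding statement with C^{(k)}(u_{k+1}) was proven
in [8, Eq. (2.113)]."* — the unnumbered display DERIVED from its two printed inputs in their printed shapes, and p36's (5.9.5)
(`BIJ88Ineq595Proof.ineq595`) re-derived with its displayed hypothesis `h2113` pushed back this one printed step (kind
«hence-step» for row **C2.Eq5.9.4-5.9.5**; theorems only).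

statement-level skeleton of published theorems with citation tags; proofs where landed; nothing here is a claim about the Yang–Mills mass gap

PDF held: `paper:balaban1988-cmp114-bij-abelian-higgs-effective-action` (journal page = PDF page + 256); pp. 264–265 [PDF 8–9]
((2.45)–(2.47)) and pp. 296–297 [PDF 40–41] ((5.9.2), the display, (5.9.5)) read this session from the text layer
(`lit read … `, files `p0008.txt`, `p0009.txt`, `p0040.txt`, `p0041.txt`); (2.47) verbatim as quoted in `BIJ88Close247Animals`.

CITATION HEADER (lean-in-tree rule).  Part of the lit-balaban TYPED SKELETON (HOME `run/shared/lean/pub/lit-balaban/`), Phase 2,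
seat p02 gen 7 (unit `lit-balaban-p02`); row **C2.Eq5.9.4-5.9.5** of `HOME/lit-balaban-r16/ROWS-C2-part2.md` (fold owner r16,
referee ref-5; TAKING line HOME/STATUS.md 2026-08-21T18:34:32Z).  p36's `BIJ88Ineq595Proof` (p. 297, (5.9.5)) takes the display
ITSELF — for `C^{(k)}_{loc}` — as the displayed hypothesis `h2113` and says verbatim *"not re-proved here"*; [8, (2.113)]
(= row B2.Lem2.7, [Balaban1983HiggsII] Lemma 2.7, whose decl of record `B2Sect2Statements.Lemma27Printed` is inhabited for the model
family by `B2Lemma27Proof.lemma27Printed_model`) is the statement FOR `C^{(k)}`, and the print bridges the two by *"C^{(k)}_{loc} is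
almost equal to C^{(k)}"* = **(2.47)** p. 265 *"|C^{(k)}_{Λ,loc}(u;x₁,x₂) − C^{(k)}_Λ(u;x₁,x₂)| ≦ e^{−cr(e_k)}e^{−c|x₁−x₂|}"* (row C2.Eq2.47,
proved p246497/p249176).  WHAT IS PROVED HERE (0 `sorry`, standard axioms, no definitions, no named facts), on p36's carriers
(`u` a unimodular ℂ-valued bond field on `T_η = Balaban1983to89.Site P j`, block field `ψ` on coarse sites `κ`, block label `blk x`,
contours `Γ_{y,x}` as data, `(Q(u)*ψ)(x) = conj(u(Γ_{blk x,x}))ψ(blk x)` as in `BIJ88Ineq595Proof`; the operators `C^{(k)}(u)`,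
`C^{(k)}_{loc}(u)` as complex KERNELS `C`, `Cloc` on `T_η` (fine-lattice weights absorbed as printed), `aL^{−2}C Q*ψ` the kernel sum):
* §1 `norm_kernel_sum_le` (a kernel with row sums `≤ R` maps a field bounded by `G` to one bounded by `RG`),
  `rowsum_le_of_close247` ((2.47) + a lattice sum `Σ_{x′}e^{−c dist(x,x′)} ≤ S` ⇒ row sums of `C_{loc} − C` are `≤ e^{−cr(e_k)}S`),
  `close247_cast` (r18's real-kernel `BIJ88Sect2Statements.Close dist Cloc C e^{−cr(e_k)} c` ⇒ the complex-kernel shape used here);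
* §2 **`display297_of_2113`** — THE PRINTED STEP: from [8, (2.113)] for `C` (`‖aL^{−2}(CQ*ψ)(x) − (Q*ψ)(x)‖ ≤ c₃p(e_k)` on `Λ₇`),
  (2.47), the lattice sum `S` and a sup bound `‖ψ‖ ≤ K_ψ`: `‖aL^{−2}(C_{loc}Q*ψ)(x) − (Q*ψ)(x)‖ ≤ c₃p(e_k) + aL^{−2}e^{−cr(e_k)}SK_ψ` on `Λ₇`;
* §3 the regime that makes the second term `O(p(e_k))`: with the (5.9.2) ball `‖ψ(y)‖ ≤ K₀p(e_k)λ_k^{−1/4}` (both regimes, the uniform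
  shape of `BIJ88Ineq297.restr592_ball`) and `e_k²/λ_k = e²/λ` ((2.2); p. 266 *"e_k²/λ_k = O(1)"*, `BIJ88Sect2Statements.eK_sq_div_lamK`):
  `λ_k^{−1/4} = (e²/λ)^{1/4}e_k^{−1/2}` (`lamk_rpow_neg_quarter`) and, since `r > 1` in (2.3), `e^{−cr(e_k)}e_k^{−1/2} ≤ 1` for `e_k`
  below a threshold depending on `c, r` only (`eventually_rpow_neg_mul_exp_neg_rLen_le_one`, `regime297`);
* §4 **`display297`** — the display with an EXPLICIT constant: `‖aL^{−2}(C_{loc}Q*ψ)(x) − (Q*ψ)(x)‖ ≤ (c₃ + aL^{−2}SK₀(e²/λ)^{1/4})p(e_k)`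
  on `Λ₇`, and **`ineq595_of_2113C`** — p36's (5.9.5) `Ineq595 … (φ − χ₇·aL^{−2}C_{loc}Q*ψ) (c₁ + 2n_Γc₂ + c₃ + aL^{−2}SK₀(e²/λ)^{1/4}) p(e_k)`
  with `h2113` replaced by the (2.113)-for-`C` input, (2.47), the lattice sum, the (5.9.2) ball and the regime inequality.
* §5 (v1.1) `h2113C_of_lemma27Printed` / `ineq595_of_lemma27Printed` — the [8] input BY NAME: an instance of the cell's typed
  [Balaban1982Higgs2] Lemma 2.7 `Balaban1983to89.B2Sect2Statements.Lemma27Printed` (row B2.Lem2.7) dominating the pointwise deviation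
  for `C^{(k)}` supplies `h2113C` (its uniform constant = `c₃`).
READINGS (declared): the sup bound on `ψ` is taken at every coarse site feeding the kernels (the kernels are those restricted to
the region, (2.39)–(2.40) Dirichlet); the constant depends on the fixed couplings through `(e²/λ)^{1/4}` and on `K₀` (which carries
`λ^{−1/4}`, `BIJ88Ineq297`) — uniform in `k`, `e_k`, as the paper's `O(·)`; the same `u` in `C`, `C_{loc}`, `Q*` (the passage
`ũ_{k+1}/u_k → u_{k+1}` of pp. 296–297 is not formalized, as in p36's files).  NOT here: [8, (2.113)] itself, (2.47) itself, (5.9.2)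
itself (rows B2.Lem2.7, C2.Eq2.47, C2.Eq5.9.1-5.9.2 — DEPGRAPH edges, entering as displayed hypotheses); no Summits import.
-/

open Filter Set
open scoped Topology

namespace Literature.MathematicalPhysics.QuantumFieldTheory.BalabanImbrieJaffe1984to88.BIJ88Display297Cloc

open Literature.MathematicalPhysics.QuantumFieldTheory.Balaban1983to89
open BIJ88Sect2Statements (rLen pLog Close)
open BIJ88Sect3Statements BIJ88Sect5StatementsPart2 BIJ88Sect5StatementsPart4 BIJ88Ineq593Proof BIJ88Ineq595Proof
open Complex

/-! ## §1 Kernel sums: row-sum bounds, (2.47) ⇒ small row sums of `C_{loc} − C` -/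

section Kernels

variable {α : Type*} [Fintype α]

/-- a kernel with row sums `Σ_{x′}‖K(x,x′)‖ ≤ R` applied to a field bounded by `G ≥ 0`: `‖Σ_{x′}K(x,x′)g(x′)‖ ≤ RG` — the `ℓ^∞`
mechanism behind *"C_{loc} almost equal to C ⇒ aL^{−2}C_{loc}Q*ψ almost equal to aL^{−2}CQ*ψ"*. [cite: BalabanImbrieJaffe1988, (5.9.5) p.297] -/
theorem norm_kernel_sum_le (K : α → α → ℂ) (g : α → ℂ) {R G : ℝ} (hG0 : 0 ≤ G) (x : α)
    (hR : ∑ x', ‖K x x'‖ ≤ R) (hg : ∀ x', ‖g x'‖ ≤ G) : ‖∑ x', K x x' * g x'‖ ≤ R * G := by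
  calc ‖∑ x', K x x' * g x'‖ ≤ ∑ x', ‖K x x' * g x'‖ := norm_sum_le _ _
    _ = ∑ x', ‖K x x'‖ * ‖g x'‖ := by simp_rw [norm_mul]
    _ ≤ ∑ x', ‖K x x'‖ * G := Finset.sum_le_sum fun x' _ => mul_le_mul_of_nonneg_left (hg x') (norm_nonneg _)
    _ = (∑ x', ‖K x x'‖) * G := by rw [Finset.sum_mul]
    _ ≤ R * G := mul_le_mul_of_nonneg_right hR hG0

/-- **(2.47)** p. 265, *"|C^{(k)}_{Λ,loc}(u;x₁,x₂) − C^{(k)}_Λ(u;x₁,x₂)| ≦ e^{−cr(e_k)}e^{−c|x₁−x₂|}"*, together with a lattice sum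
`Σ_{x′}e^{−c dist(x,x′)} ≤ S`, bounds every row sum of `C_{loc} − C` by `e^{−cr(e_k)}S` — *"C^{(k)}_{loc} is almost equal to C^{(k)}"*
(p. 297) made quantitative. [cite: BalabanImbrieJaffe1988, (2.47) p.265] -/
theorem rowsum_le_of_close247 {dist : α → α → ℝ} {Cloc C : α → α → ℂ} {c rek S : ℝ}
    (hclose : ∀ x x', ‖Cloc x x' - C x x'‖ ≤ Real.exp (-c * rek) * Real.exp (-c * dist x x'))
    (hS : ∀ x, ∑ x', Real.exp (-c * dist x x') ≤ S) (x : α) :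
    ∑ x', ‖Cloc x x' - C x x'‖ ≤ Real.exp (-c * rek) * S := by
  calc ∑ x', ‖Cloc x x' - C x x'‖ ≤ ∑ x', Real.exp (-c * rek) * Real.exp (-c * dist x x') :=
        Finset.sum_le_sum fun x' _ => hclose x x'
    _ = Real.exp (-c * rek) * ∑ x', Real.exp (-c * dist x x') := by rw [Finset.mul_sum]
    _ ≤ Real.exp (-c * rek) * S := mul_le_mul_of_nonneg_left (hS x) (Real.exp_pos _).le

omit [Fintype α] in
/-- dictionary: r18's REAL-kernel closeness `BIJ88Sect2Statements.Close dist Cloc C e^{−cr(e_k)} c` (the typed shape of (2.47)) gives the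
complex-kernel shape used in this file for the kernels cast to `ℂ`. [cite: BalabanImbrieJaffe1988, (2.47) p.265] -/
theorem close247_cast {dist : α → α → ℝ} {Cloc C : α → α → ℝ} {c rek : ℝ} (h : Close dist Cloc C (Real.exp (-c * rek)) c)
    (x x' : α) : ‖((Cloc x x' : ℝ) : ℂ) - ((C x x' : ℝ) : ℂ)‖ ≤ Real.exp (-c * rek) * Real.exp (-c * dist x x') := by
  rw [← Complex.ofReal_sub, Complex.norm_real, Real.norm_eq_abs]
  exact h x x'

end Kernels

/-! ## §2 The printed step: [8, (2.113)] for `C` + (2.47) ⇒ the p. 297 display for `C_{loc}` -/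

section Display

variable {P : Params} {j : ℕ} {κ : Type*}

/-- `‖(Q(u)*ψ)(x)‖ = ‖ψ(blk x)‖` for unimodular transporters (`(Q(u)*ψ)(x) = conj(u(Γ_{blk x,x}))ψ(blk x)`, `BIJ88Ineq595Proof`).
[cite: BalabanImbrieJaffe1988, (5.8.1) p.295] -/
theorem norm_qstar_eq (u : PBond P j → ℂ) (hu : ∀ b, ‖u b‖ = 1) (Γ : κ → Balaban1983to89.Site P j → Contour P j) (ψ : κ → ℂ)
    (blk : Balaban1983to89.Site P j → κ) (x : Balaban1983to89.Site P j) :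
    ‖(starRingEnd ℂ) (transport u (Γ (blk x) x)) * ψ (blk x)‖ = ‖ψ (blk x)‖ := by
  rw [norm_mul, Complex.norm_conj, norm_transport u hu, one_mul]

/-- **p. 297, THE PRINTED STEP** [PDF 41]: *"Note that C^{(k)}_{loc}(u_{k+1}) is almost equal to C^{(k)}(u_{k+1}). Thus we have that in
Λ₇^{(k)}, say, aL^{−2}C^{(k)}_{loc}(u_{k+1})Q(u_{k+1})*ψ = Q(u_{k+1})*ψ + O(p(e_k)), (the corresponding statement with C^{(k)}(u_{k+1}) was
proven in [8, Eq. (2.113)]"* — from (i) the [8, (2.113)] statement FOR `C`: `‖aL^{−2}(CQ*ψ)(x) − (Q*ψ)(x)‖ ≤ c₃p(e_k)` on the region,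
(ii) (2.47) `‖C_{loc}(x,x′) − C(x,x′)‖ ≤ e^{−cr(e_k)}e^{−c dist(x,x′)}`, (iii) a lattice sum `Σ_{x′}e^{−c dist(x,x′)} ≤ S`, (iv) a sup
bound `‖ψ(y)‖ ≤ K_ψ`: `‖aL^{−2}(C_{loc}Q*ψ)(x) − (Q*ψ)(x)‖ ≤ c₃p(e_k) + aL^{−2}e^{−cr(e_k)}SK_ψ` on the region (`a ≥ 0`).
[cite: BalabanImbrieJaffe1988, (5.9.5) p.297] -/
theorem display297_of_2113 (u : PBond P j → ℂ) (hu : ∀ b, ‖u b‖ = 1) (Γ : κ → Balaban1983to89.Site P j → Contour P j)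
    (ψ : κ → ℂ) (blk : Balaban1983to89.Site P j → κ) (dist : Balaban1983to89.Site P j → Balaban1983to89.Site P j → ℝ)
    (C Cloc : Balaban1983to89.Site P j → Balaban1983to89.Site P j → ℂ) (a L : ℝ)
    (inRegion : Balaban1983to89.Site P j → Prop) {c₃ pek c rek S Kψ : ℝ} (ha : 0 ≤ a) (hKψ : 0 ≤ Kψ)
    (h2113C : ∀ x, inRegion x →
      ‖((a * L⁻¹ ^ 2 : ℝ) : ℂ) * (∑ x', C x x' * ((starRingEnd ℂ) (transport u (Γ (blk x') x')) * ψ (blk x')))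
        - (starRingEnd ℂ) (transport u (Γ (blk x) x)) * ψ (blk x)‖ ≤ c₃ * pek)
    (hclose : ∀ x x', ‖Cloc x x' - C x x'‖ ≤ Real.exp (-c * rek) * Real.exp (-c * dist x x'))
    (hS : ∀ x, ∑ x', Real.exp (-c * dist x x') ≤ S) (hψ : ∀ y, ‖ψ y‖ ≤ Kψ) :
    ∀ x, inRegion x →
      ‖((a * L⁻¹ ^ 2 : ℝ) : ℂ) * (∑ x', Cloc x x' * ((starRingEnd ℂ) (transport u (Γ (blk x') x')) * ψ (blk x')))
        - (starRingEnd ℂ) (transport u (Γ (blk x) x)) * ψ (blk x)‖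
        ≤ c₃ * pek + a * L⁻¹ ^ 2 * (Real.exp (-c * rek) * S) * Kψ := by
  intro x hx
  set q : Balaban1983to89.Site P j → ℂ := fun x' => (starRingEnd ℂ) (transport u (Γ (blk x') x')) * ψ (blk x') with hq
  have hqb : ∀ x', ‖q x'‖ ≤ Kψ := fun x' => by rw [hq]; simp only; rw [norm_qstar_eq u hu Γ ψ blk x']; exact hψ (blk x')
  have hsplit : ((a * L⁻¹ ^ 2 : ℝ) : ℂ) * (∑ x', Cloc x x' * q x') - q x =
      (((a * L⁻¹ ^ 2 : ℝ) : ℂ) * (∑ x', C x x' * q x') - q x) +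
        ((a * L⁻¹ ^ 2 : ℝ) : ℂ) * ∑ x', (Cloc x x' - C x x') * q x' := by
    have hsum : ∑ x', Cloc x x' * q x' = ∑ x', C x x' * q x' + ∑ x', (Cloc x x' - C x x') * q x' := by
      rw [← Finset.sum_add_distrib]
      exact Finset.sum_congr rfl fun x' _ => by ring
    rw [hsum]; ring
  have hdiff : ‖((a * L⁻¹ ^ 2 : ℝ) : ℂ) * ∑ x', (Cloc x x' - C x x') * q x'‖ ≤
      a * L⁻¹ ^ 2 * (Real.exp (-c * rek) * S) * Kψ := by
    rw [norm_mul, Complex.norm_real, Real.norm_of_nonneg (mul_nonneg ha (sq_nonneg _))]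
    have hk : ‖∑ x', (Cloc x x' - C x x') * q x'‖ ≤ Real.exp (-c * rek) * S * Kψ :=
      norm_kernel_sum_le (fun x x' => Cloc x x' - C x x') q hKψ x (rowsum_le_of_close247 hclose hS x) hqb
    calc a * L⁻¹ ^ 2 * ‖∑ x', (Cloc x x' - C x x') * q x'‖ ≤ a * L⁻¹ ^ 2 * (Real.exp (-c * rek) * S * Kψ) :=
        mul_le_mul_of_nonneg_left hk (mul_nonneg ha (sq_nonneg _))
      _ = a * L⁻¹ ^ 2 * (Real.exp (-c * rek) * S) * Kψ := by ring
  have hmain := h2113C x hx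
  change ‖((a * L⁻¹ ^ 2 : ℝ) : ℂ) * (∑ x', C x x' * q x') - q x‖ ≤ c₃ * pek at hmain
  change ‖((a * L⁻¹ ^ 2 : ℝ) : ℂ) * (∑ x', Cloc x x' * q x') - q x‖ ≤ _
  rw [hsplit]
  exact (norm_add_le _ _).trans (add_le_add hmain hdiff)

end Display

/-! ## §3 The regime: `λ_k^{−1/4} = (e²/λ)^{1/4}e_k^{−1/2}` and `e^{−cr(e_k)}e_k^{−1/2} ≤ 1` for small `e_k` (`r > 1`) -/

section Regime

/-- **(2.2)** p. 260 / p. 266 *"e_k²/λ_k = O(1)"* (`= e²/λ`, `BIJ88Sect2Statements.eK_sq_div_lamK`): for positive `e, λ, e_k` with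
`e_k²/λ_k = e²/λ`, `λ_k^{−1/4} = (e²/λ)^{1/4}·e_k^{−1/2}` — the (5.9.2) radius `p(e_k)λ_k^{−1/4}` grows only like `e_k^{−1/2}`.
[cite: BalabanImbrieJaffe1988, (2.2) p.260] -/
theorem lamk_rpow_neg_quarter {e lam ek lamk : ℝ} (he : 0 < e) (hlam : 0 < lam) (hek : 0 < ek)
    (hratio : ek ^ 2 / lamk = e ^ 2 / lam) :
    lamk ^ (-(1 / 4 : ℝ)) = (e ^ 2 / lam) ^ (1 / 4 : ℝ) * ek ^ (-(1 / 2 : ℝ)) := by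
  have hlamk_ne : lamk ≠ 0 := by
    intro h0
    rw [h0, div_zero] at hratio
    exact absurd hratio.symm (div_pos (pow_pos he 2) hlam).ne'
  have hlamk : lamk = lam / e ^ 2 * ek ^ 2 := by
    field_simp at hratio
    field_simp
    linarith
  have hle : 0 ≤ lam / e ^ 2 := (div_pos hlam (pow_pos he 2)).le
  rw [hlamk, Real.mul_rpow hle (sq_nonneg ek)]
  have h1 : (lam / e ^ 2) ^ (-(1 / 4 : ℝ)) = (e ^ 2 / lam) ^ (1 / 4 : ℝ) := by
    rw [Real.rpow_neg hle, ← Real.inv_rpow hle, inv_div]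
  have h2 : (ek ^ 2) ^ (-(1 / 4 : ℝ)) = ek ^ (-(1 / 2 : ℝ)) := by
    rw [← Real.rpow_natCast ek 2, ← Real.rpow_mul hek.le]
    norm_num
  rw [h1, h2]

/-- the small-coupling regime of **(2.3)** p. 260 (*"r(e_k) = |log e_k⁻¹|^r, r > 1"*): for every `τ` and every `c > 0`,
`e_k^{−τ}·e^{−c r(e_k)} ≤ 1` for all sufficiently small `e_k > 0` — a power of `e_k⁻¹` is `exp(τ log e_k⁻¹)` and `τu ≤ cu^r` for large
`u = log e_k⁻¹` because `r > 1`. [cite: BalabanImbrieJaffe1988, (2.3) p.260] -/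
theorem eventually_rpow_neg_mul_exp_neg_rLen_le_one (τ c r : ℝ) (hc : 0 < c) (hr : 1 < r) :
    ∀ᶠ x : ℝ in 𝓝[>] 0, x ^ (-τ) * Real.exp (-(c * rLen r x)) ≤ 1 := by
  -- on `u → +∞`: `τ·u ≤ c·u^r` eventually (`u^{r−1} ≥ τ/c`)
  have hev : ∀ᶠ u : ℝ in atTop, τ * u ≤ c * u ^ r := by
    filter_upwards [(tendsto_rpow_atTop (by linarith : 0 < r - 1)).eventually_ge_atTop (τ / c),
      eventually_ge_atTop (0 : ℝ)] with u hu hu0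
    have hsplit : u ^ r = u ^ (r - 1) * u := by
      rcases hu0.eq_or_lt with h0 | hpos
      · rw [← h0, Real.zero_rpow (by linarith), mul_zero]
      · rw [← Real.rpow_add_one hpos.ne' (r - 1)]; ring_nf
    rw [hsplit]
    calc τ * u = c * (τ / c) * u := by field_simp
      _ ≤ c * u ^ (r - 1) * u := by
          exact mul_le_mul_of_nonneg_right (mul_le_mul_of_nonneg_left hu hc.le) hu0
      _ = c * (u ^ (r - 1) * u) := by ring
  have hmem : ∀ᶠ x : ℝ in 𝓝[>] 0, x ∈ Ioo (0 : ℝ) 1 := Ioo_mem_nhdsGT one_pos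
  filter_upwards [BIJ88SmallCoupling23.tendsto_abs_log_inv.eventually hev, hmem] with x hx hx01
  have hlog : 0 ≤ Real.log x⁻¹ := Real.log_nonneg ((one_le_inv₀ hx01.1).mpr hx01.2.le)
  rw [abs_of_nonneg hlog] at hx
  have hpow : x ^ (-τ) = Real.exp (τ * Real.log x⁻¹) := by
    rw [Real.rpow_def_of_pos hx01.1, Real.log_inv]; ring_nf
  have hr' : rLen r x = Real.log x⁻¹ ^ r := by rw [rLen, abs_of_nonneg hlog]
  rw [hpow, hr', ← Real.exp_add]
  exact Real.exp_le_one_iff.mpr (by linarith)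

/-- the regime inequality used for the display, as a threshold statement: there is `δ > 0` (depending on `c, r` only) with
`e^{−cr(e_k)}e_k^{−1/2} ≤ 1` for `0 < e_k < δ`. [cite: BalabanImbrieJaffe1988, (2.3) p.260] -/
theorem regime297 (c r : ℝ) (hc : 0 < c) (hr : 1 < r) :
    ∃ δ > 0, ∀ ek : ℝ, 0 < ek → ek < δ → Real.exp (-(c * rLen r ek)) * ek ^ (-(1 / 2 : ℝ)) ≤ 1 := by
  obtain ⟨δ, hδ, h⟩ := (nhdsGT_basis (0 : ℝ)).eventually_iff.mp
    (eventually_rpow_neg_mul_exp_neg_rLen_le_one (1 / 2) c r hc hr)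
  exact ⟨δ, hδ, fun ek h0 h1 => by rw [mul_comm]; exact h ⟨h0, h1⟩⟩

end Regime

/-! ## §4 The display with an explicit constant, and (5.9.5) from [8, (2.113)] for `C` -/

section Main

variable {P : Params} {j : ℕ} {κ : Type}

/-- **p. 297, THE DISPLAY** [PDF 41] *"in Λ₇^{(k)}: aL^{−2}C^{(k)}_{loc}(u_{k+1})Q(u_{k+1})*ψ = Q(u_{k+1})*ψ + O(p(e_k))"* with an EXPLICIT
constant: from [8, (2.113)] for `C` (constant `c₃`), (2.47) at localization length `r(e_k) = rLen r e_k` (constant `c`), the lattice sum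
`S`, the (5.9.2) ball `‖ψ(y)‖ ≤ K₀p(e_k)λ_k^{−1/4}` (`BIJ88Ineq297.restr592_ball` shape), `e_k²/λ_k = e²/λ` ((2.2)) and the regime
inequality `e^{−cr(e_k)}e_k^{−1/2} ≤ 1` (`regime297`): `‖aL^{−2}(C_{loc}Q*ψ)(x) − (Q*ψ)(x)‖ ≤ (c₃ + aL^{−2}SK₀(e²/λ)^{1/4})·p(e_k)` on `Λ₇`.
[cite: BalabanImbrieJaffe1988, (5.9.5) p.297] -/
theorem display297 (u : PBond P j → ℂ) (hu : ∀ b, ‖u b‖ = 1) (Γ : κ → Balaban1983to89.Site P j → Contour P j)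
    (ψ : κ → ℂ) (blk : Balaban1983to89.Site P j → κ) (dist : Balaban1983to89.Site P j → Balaban1983to89.Site P j → ℝ)
    (C Cloc : Balaban1983to89.Site P j → Balaban1983to89.Site P j → ℂ) (a L : ℝ)
    (inRegion : Balaban1983to89.Site P j → Prop) {c₃ pek c r S K₀ e lam ek lamk : ℝ} (ha : 0 ≤ a) (hS0 : 0 ≤ S)
    (hK₀ : 0 ≤ K₀) (hpek : 0 ≤ pek) (he : 0 < e) (hlam : 0 < lam) (hek : 0 < ek) (hratio : ek ^ 2 / lamk = e ^ 2 / lam)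
    (hsmall : Real.exp (-(c * rLen r ek)) * ek ^ (-(1 / 2 : ℝ)) ≤ 1)
    (h2113C : ∀ x, inRegion x →
      ‖((a * L⁻¹ ^ 2 : ℝ) : ℂ) * (∑ x', C x x' * ((starRingEnd ℂ) (transport u (Γ (blk x') x')) * ψ (blk x')))
        - (starRingEnd ℂ) (transport u (Γ (blk x) x)) * ψ (blk x)‖ ≤ c₃ * pek)
    (hclose : ∀ x x', ‖Cloc x x' - C x x'‖ ≤ Real.exp (-c * rLen r ek) * Real.exp (-c * dist x x'))
    (hS : ∀ x, ∑ x', Real.exp (-c * dist x x') ≤ S) (hψ : ∀ y, ‖ψ y‖ ≤ K₀ * pek * lamk ^ (-(1 / 4 : ℝ))) :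
    ∀ x, inRegion x →
      ‖((a * L⁻¹ ^ 2 : ℝ) : ℂ) * (∑ x', Cloc x x' * ((starRingEnd ℂ) (transport u (Γ (blk x') x')) * ψ (blk x')))
        - (starRingEnd ℂ) (transport u (Γ (blk x) x)) * ψ (blk x)‖
        ≤ (c₃ + a * L⁻¹ ^ 2 * S * K₀ * (e ^ 2 / lam) ^ (1 / 4 : ℝ)) * pek := by
  intro x hx
  have hKψ : 0 ≤ K₀ * pek * lamk ^ (-(1 / 4 : ℝ)) := by
    rw [lamk_rpow_neg_quarter he hlam hek hratio]
    exact mul_nonneg (mul_nonneg hK₀ hpek)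
      (mul_nonneg (Real.rpow_nonneg (div_pos (pow_pos he 2) hlam).le _) (Real.rpow_nonneg hek.le _))
  have h := display297_of_2113 u hu Γ ψ blk dist C Cloc a L inRegion ha hKψ h2113C hclose hS hψ x hx
  refine h.trans ?_
  have hquart : 0 ≤ (e ^ 2 / lam) ^ (1 / 4 : ℝ) := Real.rpow_nonneg (div_pos (pow_pos he 2) hlam).le _
  -- the second term: aL⁻²·e^{−cr}S·K₀ p λ_k^{−1/4} = aL⁻²SK₀p·(e²/λ)^{1/4}·(e^{−cr}e_k^{−1/2}) ≤ aL⁻²SK₀(e²/λ)^{1/4}·p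
  have hkey : a * L⁻¹ ^ 2 * (Real.exp (-c * rLen r ek) * S) * (K₀ * pek * lamk ^ (-(1 / 4 : ℝ)))
      ≤ a * L⁻¹ ^ 2 * S * K₀ * (e ^ 2 / lam) ^ (1 / 4 : ℝ) * pek := by
    rw [lamk_rpow_neg_quarter he hlam hek hratio]
    have hre : a * L⁻¹ ^ 2 * (Real.exp (-c * rLen r ek) * S) * (K₀ * pek * ((e ^ 2 / lam) ^ (1 / 4 : ℝ) * ek ^ (-(1 / 2 : ℝ))))
        = a * L⁻¹ ^ 2 * S * K₀ * (e ^ 2 / lam) ^ (1 / 4 : ℝ) * pek * (Real.exp (-(c * rLen r ek)) * ek ^ (-(1 / 2 : ℝ))) := by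
      rw [neg_mul]; ring
    rw [hre]
    have hnn : 0 ≤ a * L⁻¹ ^ 2 * S * K₀ * (e ^ 2 / lam) ^ (1 / 4 : ℝ) * pek :=
      mul_nonneg (mul_nonneg (mul_nonneg (mul_nonneg (mul_nonneg ha (sq_nonneg _)) hS0) hK₀) hquart) hpek
    calc _ ≤ a * L⁻¹ ^ 2 * S * K₀ * (e ^ 2 / lam) ^ (1 / 4 : ℝ) * pek * 1 := mul_le_mul_of_nonneg_left hsmall hnn
      _ = _ := mul_one _
  calc c₃ * pek + a * L⁻¹ ^ 2 * (Real.exp (-c * rLen r ek) * S) * (K₀ * pek * lamk ^ (-(1 / 4 : ℝ)))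
      ≤ c₃ * pek + a * L⁻¹ ^ 2 * S * K₀ * (e ^ 2 / lam) ^ (1 / 4 : ℝ) * pek := add_le_add le_rfl hkey
    _ = (c₃ + a * L⁻¹ ^ 2 * S * K₀ * (e ^ 2 / lam) ^ (1 / 4 : ℝ)) * pek := by ring

/-- **(5.9.5)** p. 297 [PDF 41] *"|φ^{(k)}(x)| ≤ cp(e_k), x ∈ Λ₇^{(k)*}"* with the [8, (2.113)] input taken FOR `C^{(k)}` as printed: p36's
`BIJ88Ineq595Proof.ineq595` (φ^{(k)} = φ − Λ₇aL^{−2}C_{loc}Q*ψ of (5.8.1), the restrictions `‖ψ − Q(u)φ‖ ≤ c₁p(e_k)`, `‖D_uφ‖ ≤ c₂p(e_k)`)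
with its displayed hypothesis `h2113` DISCHARGED by `display297` — i.e. from (2.113) for `C` (`c₃`), (2.47) (`c`, `r(e_k)`), the lattice
sum `S`, the (5.9.2) ball (`K₀`), `e_k²/λ_k = e²/λ` and the regime inequality: `‖φ^{(k)}(x)‖ ≤ (c₁ + 2n_Γc₂ + (c₃ + aL^{−2}SK₀(e²/λ)^{1/4}))p(e_k)`
on the region. [cite: BalabanImbrieJaffe1988, (5.9.5) p.297] -/
theorem ineq595_of_2113C (u : PBond P j → ℂ) (hu : ∀ b, ‖u b‖ = 1) (φ : Balaban1983to89.Site P j → ℂ)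
    (B : κ → Finset (Balaban1983to89.Site P j)) (w : ℝ) (hw : 0 ≤ w) (base : κ → Balaban1983to89.Site P j)
    (Γ : κ → Balaban1983to89.Site P j → Contour P j) (ψ : κ → ℂ) (blk : Balaban1983to89.Site P j → κ)
    (dist : Balaban1983to89.Site P j → Balaban1983to89.Site P j → ℝ)
    (C Cloc : Balaban1983to89.Site P j → Balaban1983to89.Site P j → ℂ) (a L : ℝ) (χ₇ : Balaban1983to89.Site P j → ℂ)
    (inRegion : Balaban1983to89.Site P j → Prop) {c₁ c₂ c₃ pek c r S K₀ e lam ek lamk : ℝ} {nΓ : ℕ} (hpek : 0 ≤ pek)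
    (hc₂ : 0 ≤ c₂) (ha : 0 ≤ a) (hS0 : 0 ≤ S) (hK₀ : 0 ≤ K₀) (he : 0 < e) (hlam : 0 < lam) (hek : 0 < ek)
    (hratio : ek ^ 2 / lamk = e ^ 2 / lam) (hsmall : Real.exp (-(c * rLen r ek)) * ek ^ (-(1 / 2 : ℝ)) ≤ 1)
    (hχ₇ : ∀ x, inRegion x → χ₇ x = 1) (hblk : ∀ x, inRegion x → x ∈ B (blk x))
    (hB : ∀ x, inRegion x → ((B (blk x)).card : ℝ) * w = 1)
    (hΓ : ∀ z, ∀ x ∈ B z, IsPath (base z) (Γ z x) x) (hlenΓ : ∀ z, ∀ x ∈ B z, (Γ z x).length ≤ nΓ)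
    (h2113C : ∀ x, inRegion x →
      ‖((a * L⁻¹ ^ 2 : ℝ) : ℂ) * (∑ x', C x x' * ((starRingEnd ℂ) (transport u (Γ (blk x') x')) * ψ (blk x')))
        - (starRingEnd ℂ) (transport u (Γ (blk x) x)) * ψ (blk x)‖ ≤ c₃ * pek)
    (hclose : ∀ x x', ‖Cloc x x' - C x x'‖ ≤ Real.exp (-c * rLen r ek) * Real.exp (-c * dist x x'))
    (hS : ∀ x, ∑ x', Real.exp (-c * dist x x') ≤ S) (hψball : ∀ y, ‖ψ y‖ ≤ K₀ * pek * lamk ^ (-(1 / 4 : ℝ)))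
    (hψ : ∀ x, inRegion x → ‖ψ (blk x) - covAvg B w (fun z x => transport u (Γ z x)) φ (blk x)‖ ≤ c₁ * pek)
    (hφ : ∀ x, inRegion x → ∀ x' ∈ B (blk x),
      ∀ s ∈ ((Γ (blk x) x).reverse.map fun s => (s.1, !s.2)) ++ Γ (blk x) x', ‖covD 1 u φ s.1‖ ≤ c₂ * pek) :
    Ineq595 (Balaban1983to89.Site P j) inRegion
      (fun x => φ x - χ₇ x *
        (((a * L⁻¹ ^ 2 : ℝ) : ℂ) * ∑ x', Cloc x x' * ((starRingEnd ℂ) (transport u (Γ (blk x') x')) * ψ (blk x'))))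
      (c₁ + 2 * nΓ * c₂ + (c₃ + a * L⁻¹ ^ 2 * S * K₀ * (e ^ 2 / lam) ^ (1 / 4 : ℝ))) pek := by
  -- the display for `C_loc`, in the shape of p36's displayed hypothesis `h2113`
  have hd := display297 u hu Γ ψ blk dist C Cloc a L inRegion ha hS0 hK₀ hpek he hlam hek hratio hsmall h2113C hclose hS
    hψball
  -- p36's (5.9.5) with `T := aL⁻²C_loc Q*` fed by the display
  have h := ineq595 u hu φ B w hw base Γ ψ blk
    (fun ψ' x => ((a * L⁻¹ ^ 2 : ℝ) : ℂ) * ∑ x', Cloc x x' * ((starRingEnd ℂ) (transport u (Γ (blk x') x')) * ψ' (blk x')))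
    χ₇ inRegion (c₃ := c₃ + a * L⁻¹ ^ 2 * S * K₀ * (e ^ 2 / lam) ^ (1 / 4 : ℝ)) hpek hc₂ hχ₇ hblk hB hΓ hlenΓ hd hψ hφ
  intro x hx
  exact h x hx

end Main

/-! ## §5 (v1.1, append-only) [8, (2.113)] BY NAME: the cell's decl of record for [8] Lemma 2.7 feeds `h2113C` -/

section ByName

variable {P : Params} {j : ℕ} {κ : Type}

/-- dictionary to the cell's typed [8] = [Balaban1982Higgs2] Lemma 2.7 (row B2.Lem2.7, decl of record
`Balaban1983to89.B2Sect2Statements.Lemma27Printed`, typed by r02 with `dev2113` = *"sup over x ∈ Λ₅^{(k)} of |aL⁻²(C^{(k)}…Q*ψ)(x) −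
(Q*ψ)(x)|"* and `p` = p(L^kε); inhabited for the model family by `B2Lemma27Proof.lemma27Printed_model`): if an instance `i₀` of a
family satisfying `Lemma27Printed` has `p = p(e_k)`, its restriction clause holds, and its `dev2113` dominates the pointwise deviation
FOR `C^{(k)}` on the region, then the hypothesis `h2113C` of `display297`/`ineq595_of_2113C` holds with `c₃` = the Lemma's uniform
constant — the DEPGRAPH edge C2.Eq5.9.4-5.9.5 → B2.Lem2.7 as a Lean implication. [cite: BalabanImbrieJaffe1988, (5.9.5) p.297] -/
theorem h2113C_of_lemma27Printed {I : Type} (fam : I → B2Sect2Statements.L27Setting)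
    (h27 : B2Sect2Statements.Lemma27Printed fam) (i₀ : I) (hrestr : (fam i₀).restrψ) {pek : ℝ} (hp : (fam i₀).p = pek)
    (u : PBond P j → ℂ) (Γ : κ → Balaban1983to89.Site P j → Contour P j) (ψ : κ → ℂ) (blk : Balaban1983to89.Site P j → κ)
    (C : Balaban1983to89.Site P j → Balaban1983to89.Site P j → ℂ) (a L : ℝ) (inRegion : Balaban1983to89.Site P j → Prop)
    (hdev : ∀ x, inRegion x →
      ‖((a * L⁻¹ ^ 2 : ℝ) : ℂ) * (∑ x', C x x' * ((starRingEnd ℂ) (transport u (Γ (blk x') x')) * ψ (blk x')))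
        - (starRingEnd ℂ) (transport u (Γ (blk x) x)) * ψ (blk x)‖ ≤ (fam i₀).dev2113) :
    ∃ c₃ : ℝ, ∀ x, inRegion x →
      ‖((a * L⁻¹ ^ 2 : ℝ) : ℂ) * (∑ x', C x x' * ((starRingEnd ℂ) (transport u (Γ (blk x') x')) * ψ (blk x')))
        - (starRingEnd ℂ) (transport u (Γ (blk x) x)) * ψ (blk x)‖ ≤ c₃ * pek := by
  obtain ⟨c₃, hc₃⟩ := h27
  exact ⟨c₃, fun x hx => (hdev x hx).trans (by rw [← hp]; exact hc₃ i₀ hrestr)⟩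

/-- **(5.9.5) from [8] Lemma 2.7 BY NAME**: `ineq595_of_2113C` with `h2113C` supplied by an instance of the cell's typed
`B2Sect2Statements.Lemma27Printed` (its uniform constant becomes the `c₃` of the bound). [cite: BalabanImbrieJaffe1988, (5.9.5) p.297] -/
theorem ineq595_of_lemma27Printed {I : Type} (fam : I → B2Sect2Statements.L27Setting)
    (h27 : B2Sect2Statements.Lemma27Printed fam) (i₀ : I) (hrestr : (fam i₀).restrψ)
    (u : PBond P j → ℂ) (hu : ∀ b, ‖u b‖ = 1) (φ : Balaban1983to89.Site P j → ℂ)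
    (B : κ → Finset (Balaban1983to89.Site P j)) (w : ℝ) (hw : 0 ≤ w) (base : κ → Balaban1983to89.Site P j)
    (Γ : κ → Balaban1983to89.Site P j → Contour P j) (ψ : κ → ℂ) (blk : Balaban1983to89.Site P j → κ)
    (dist : Balaban1983to89.Site P j → Balaban1983to89.Site P j → ℝ)
    (C Cloc : Balaban1983to89.Site P j → Balaban1983to89.Site P j → ℂ) (a L : ℝ) (χ₇ : Balaban1983to89.Site P j → ℂ)
    (inRegion : Balaban1983to89.Site P j → Prop) {c₁ c₂ pek c r S K₀ e lam ek lamk : ℝ} {nΓ : ℕ} (hp : (fam i₀).p = pek)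
    (hpek : 0 ≤ pek) (hc₂ : 0 ≤ c₂) (ha : 0 ≤ a) (hS0 : 0 ≤ S) (hK₀ : 0 ≤ K₀) (he : 0 < e) (hlam : 0 < lam) (hek : 0 < ek)
    (hratio : ek ^ 2 / lamk = e ^ 2 / lam) (hsmall : Real.exp (-(c * rLen r ek)) * ek ^ (-(1 / 2 : ℝ)) ≤ 1)
    (hχ₇ : ∀ x, inRegion x → χ₇ x = 1) (hblk : ∀ x, inRegion x → x ∈ B (blk x))
    (hB : ∀ x, inRegion x → ((B (blk x)).card : ℝ) * w = 1)
    (hΓ : ∀ z, ∀ x ∈ B z, IsPath (base z) (Γ z x) x) (hlenΓ : ∀ z, ∀ x ∈ B z, (Γ z x).length ≤ nΓ)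
    (hdev : ∀ x, inRegion x →
      ‖((a * L⁻¹ ^ 2 : ℝ) : ℂ) * (∑ x', C x x' * ((starRingEnd ℂ) (transport u (Γ (blk x') x')) * ψ (blk x')))
        - (starRingEnd ℂ) (transport u (Γ (blk x) x)) * ψ (blk x)‖ ≤ (fam i₀).dev2113)
    (hclose : ∀ x x', ‖Cloc x x' - C x x'‖ ≤ Real.exp (-c * rLen r ek) * Real.exp (-c * dist x x'))
    (hS : ∀ x, ∑ x', Real.exp (-c * dist x x') ≤ S) (hψball : ∀ y, ‖ψ y‖ ≤ K₀ * pek * lamk ^ (-(1 / 4 : ℝ)))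
    (hψ : ∀ x, inRegion x → ‖ψ (blk x) - covAvg B w (fun z x => transport u (Γ z x)) φ (blk x)‖ ≤ c₁ * pek)
    (hφ : ∀ x, inRegion x → ∀ x' ∈ B (blk x),
      ∀ s ∈ ((Γ (blk x) x).reverse.map fun s => (s.1, !s.2)) ++ Γ (blk x) x', ‖covD 1 u φ s.1‖ ≤ c₂ * pek) :
    ∃ c₃ : ℝ, Ineq595 (Balaban1983to89.Site P j) inRegion
      (fun x => φ x - χ₇ x *
        (((a * L⁻¹ ^ 2 : ℝ) : ℂ) * ∑ x', Cloc x x' * ((starRingEnd ℂ) (transport u (Γ (blk x') x')) * ψ (blk x'))))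
      (c₁ + 2 * nΓ * c₂ + (c₃ + a * L⁻¹ ^ 2 * S * K₀ * (e ^ 2 / lam) ^ (1 / 4 : ℝ))) pek := by
  obtain ⟨c₃, h2113C⟩ := h2113C_of_lemma27Printed fam h27 i₀ hrestr hp u Γ ψ blk C a L inRegion hdev
  exact ⟨c₃, ineq595_of_2113C u hu φ B w hw base Γ ψ blk dist C Cloc a L χ₇ inRegion hpek hc₂ ha hS0 hK₀ he hlam hek hratio
    hsmall hχ₇ hblk hB hΓ hlenΓ h2113C hclose hS hψball hψ hφ⟩

end ByName

end Literature.MathematicalPhysics.QuantumFieldTheory.BalabanImbrieJaffe1984to88.BIJ88Display297Cloc
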